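import Literature.RingTheory.FormalGroups.FormalGroupHomAdd
import HarnessLib

/-!
# Formal `𝒪`-module laws (one-dimensional)
# ([Drinfeld 1974] §1; [Hazewinkel 1978] §21.1; [Lubin–Tate 1965] §1)

Topic `Literature/RingTheory/FormalGroups`; namespace `Literature.RingTheory.FormalGroups`.  DEFINITIONS + fully proved
theorems; no named fact, no instance, no notation, no `sorry`.  Cell `hodgecm-mathlib`, P6 «MOD programme» ROW 4B, letter
L4B.3 (sub-desk F0P6d «Lubin–Tate formal moduli»: its letter `stub_L4B3c𝒪_formalOModule_liftsAlongSurjection` is TYPED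
ON this structure — F0P6d-plan (g0) census v1 (G1), 2026-09-01).  Carrier: Mathlib's `FormalGroup A` + the cell's
`FormalGroupHom` ∕ `FormalGroupHomAdd` (homomorphisms, `add`, `comp`, `zero`, `id`, linear coefficients).

## Contents

* `FormalOModuleLaw 𝒪 A` — for a commutative ring `𝒪` and a commutative `𝒪`-algebra `A`: a COMMUTATIVE one-dimensional
  formal group law `F` over `A` together with a map `ρ : 𝒪 → End(F)`, `a ↦ [a]_F`, which is a RING HOMOMORPHISM for the
  `End(F)`-structure `(+_F, ∘)` (`[0] = 0`, `[1] = id`, `[a+b] = F([a],[b])`, `[ab] = [a] ∘ [b]`, stated on the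
  SERIES so that no instance is needed) and whose tangent action is the structure map: `[a]_F(T) ≡ a·T (mod deg 2)`
  ([Drinfeld1974] §1 Def.; [Hazewinkel1978] §21.1 (21.1.1)–(21.1.3)).
* repackaging as homomorphism identities: `act_add' : ρ (a+b) = (ρ a).add (ρ b)`, `act_mul' : ρ (ab) = (ρ a).comp (ρ b)`,
  `act_natCast : ρ n = [n]_F` (so `[p]_F = ρ p`), `act_neg_one_add : F([−1](T), T) = 0` (the inverse series comes for free).
* base change `FormalOModuleLaw.map (f : A →ₐ[𝒪] A′)` (with `isComm_map : (F.map f).IsComm`), [Hazewinkel1978] (21.1.4).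
* the example `additive 𝒪 A` (`𝔾̂ₐ` with `[a](T) = a·T`).
* `𝒪`-HEIGHT as a `Prop`: `IsOfHeight M π q h` ⟺ `[π]_F(T) = u(T^{q^h})` for some `u ∈ T·A⟦T⟧` with unit linear coefficient
  ([Drinfeld1974] §1; [HarrisTaylorAMS2001] II.1 p. 59; for `A ⊇ 𝒪∕π` an `𝔽_q`-algebra this is the usual height).

Deliberately NOT here: existence of Lubin–Tate laws `F_f` (`[π]_f = f`), uniqueness∕universality (`Λ_𝒪`), the lifting letter
L4B.3c𝒪 itself, `ℕ∞`-valued height and its well-definedness (needs `A` reduced), logarithms.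
-/

noncomputable section

namespace Literature.RingTheory.FormalGroups

open _root_.MvPowerSeries (HasSubst subst)

universe u v w

/-! ## §0 Two facts on Mathlib's carrier -/

/-- Base change preserves commutativity: `f_* F` is commutative when `F` is. [cite: Hazewinkel1978, §1.1 (1.1.6)] -/
theorem isComm_map {A : Type v} [CommRing A] {A' : Type w} [CommRing A'] (F : FormalGroup A) [F.IsComm]
    (f : A →+* A') : (F.map f).IsComm where
  comm := by
    have hvec : (fun i => MvPowerSeries.map f ((![MvPowerSeries.X 1, MvPowerSeries.X 0] :
        Fin 2 → MvPowerSeries (Fin 2) A) i)) = ![MvPowerSeries.X 1, MvPowerSeries.X 0] := by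
      funext i; fin_cases i <;> simp
    have h := congrArg (MvPowerSeries.map f) (FormalGroup.IsComm.comm (F := F))
    rw [MvPowerSeries.map_subst MvPowerSeries.HasSubst.X_X, hvec] at h
    exact h

/-- The linear coefficient of a base-changed univariate series. [cite: Hazewinkel1978, §1.1 (1.1.6)] -/
theorem coeff_one_map {A : Type v} [CommRing A] {A' : Type w} [CommRing A'] (f : A →+* A') (φ : PowerSeries A) :
    PowerSeries.coeff 1 (PowerSeries.map f φ) = f (PowerSeries.coeff 1 φ) :=
  PowerSeries.coeff_map f 1 φ

/-! ## §1 The structure -/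

/-- A (one-dimensional) **formal `𝒪`-module law** over the commutative `𝒪`-algebra `A`: a commutative formal group law
`F` over `A` with a ring homomorphism `ρ : 𝒪 → End_A(F)`, `a ↦ [a]_F` — i.e. `[a]_F` is an endomorphism of `F`,
`[0] = 0`, `[1] = T`, `[a + b](T) = F([a](T), [b](T))`, `[ab](T) = [a]([b](T))` — such that `[a]_F(T) ≡ a·T (mod deg 2)`.
The four ring-homomorphism laws are stated on the underlying SERIES (instance-free).
[cite: Drinfeld1974, §1 Def.] [cite: Hazewinkel1978, §21.1 Def. (21.1.1)] -/
structure FormalOModuleLaw (𝒪 : Type u) [CommRing 𝒪] (A : Type v) [CommRing A] [Algebra 𝒪 A] where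
  /-- The underlying formal group law `F`. -/
  toFormalGroup : FormalGroup A
  /-- `F` is commutative. -/
  isComm : toFormalGroup.IsComm
  /-- The action `a ↦ [a]_F ∈ End(F)`. -/
  act : 𝒪 → FormalGroupHom toFormalGroup toFormalGroup
  /-- Tangent condition `[a]_F(T) ≡ a·T (mod deg 2)`. -/
  coeff_one_act : ∀ a, PowerSeries.coeff 1 (act a).toPowerSeries = algebraMap 𝒪 A a
  /-- `[0]_F = 0`. -/
  act_zero : (act 0).toPowerSeries = 0
  /-- `[1]_F = T`. -/
  act_one : (act 1).toPowerSeries = PowerSeries.X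
  /-- `[a + b]_F(T) = F([a]_F(T), [b]_F(T))`. -/
  act_add : ∀ a b, (act (a + b)).toPowerSeries =
    toFormalGroup.toPowerSeries.subst ![(act a).toPowerSeries, (act b).toPowerSeries]
  /-- `[a b]_F(T) = [a]_F([b]_F(T))`. -/
  act_mul : ∀ a b, (act (a * b)).toPowerSeries = PowerSeries.subst (act b).toPowerSeries (act a).toPowerSeries

namespace FormalOModuleLaw

variable {𝒪 : Type u} [CommRing 𝒪] {A : Type v} [CommRing A] [Algebra 𝒪 A] (M : FormalOModuleLaw 𝒪 A)

/-- The underlying law of a formal `𝒪`-module law is commutative (as an instance-providing theorem: use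
`haveI := M.isComm'`). [cite: Hazewinkel1978, §21.1 Def. (21.1.1)] -/
theorem isComm' : M.toFormalGroup.IsComm := M.isComm

/-- `[0]_F = 0` as homomorphisms. [cite: Hazewinkel1978, §21.1 Def. (21.1.1)] -/
theorem act_zero' : M.act 0 = FormalGroupHom.zero _ _ := FormalGroupHom.ext M.act_zero

/-- `[1]_F = id` as homomorphisms. [cite: Hazewinkel1978, §21.1 Def. (21.1.1)] -/
theorem act_one' : M.act 1 = FormalGroupHom.id _ := FormalGroupHom.ext M.act_one

/-- `[a + b]_F = [a]_F + [b]_F` as homomorphisms. [cite: Hazewinkel1978, §21.1 Def. (21.1.1)] -/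
theorem act_add' (a b : 𝒪) : haveI := M.isComm; M.act (a + b) = (M.act a).add (M.act b) :=
  FormalGroupHom.ext (M.act_add a b)

/-- `[a b]_F = [a]_F ∘ [b]_F` as homomorphisms. [cite: Hazewinkel1978, §21.1 Def. (21.1.1)] -/
theorem act_mul' (a b : 𝒪) : M.act (a * b) = (M.act a).comp (M.act b) := FormalGroupHom.ext (M.act_mul a b)

/-- The action of the natural numbers is the `[n]`-series: `ρ n = [n]_F`. [cite: Hazewinkel1978, §21.1 (21.1.3)] -/
theorem act_natCast (n : ℕ) : haveI := M.isComm; M.act n = FormalGroupHom.nsmulHom M.toFormalGroup n := by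
  haveI := M.isComm
  induction n with
  | zero => simpa using M.act_zero'
  | succ n ih => rw [Nat.cast_succ, act_add', ih, act_one', FormalGroupHom.nsmulHom_succ]

/-- `[a]_F` commutes with `[b]_F`. [cite: Hazewinkel1978, §21.1 Def. (21.1.1)] -/
theorem act_comm (a b : 𝒪) : (M.act a).comp (M.act b) = (M.act b).comp (M.act a) := by
  rw [← act_mul', ← act_mul', mul_comm]

/-- **The inverse comes for free**: `F([−1]_F(T), T) = 0` (since `[−1] + [1] = [0] = 0`).
[cite: Hazewinkel1978, §21.1 (21.1.3)] -/
theorem act_neg_one_add :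
    M.toFormalGroup.toPowerSeries.subst ![(M.act (-1)).toPowerSeries, PowerSeries.X] = (0 : PowerSeries A) := by
  rw [← M.act_one, ← M.act_add, neg_add_cancel, M.act_zero]

/-- `F([−a]_F(T), [a]_F(T)) = 0`. [cite: Hazewinkel1978, §21.1 (21.1.3)] -/
theorem act_neg_add (a : 𝒪) :
    M.toFormalGroup.toPowerSeries.subst ![(M.act (-a)).toPowerSeries, (M.act a).toPowerSeries] = (0 : PowerSeries A) := by
  rw [← M.act_add, neg_add_cancel, M.act_zero]

/-! ## §2 Base change -/

/-- **Base change** of a formal `𝒪`-module law along an `𝒪`-algebra map `f : A →ₐ[𝒪] A′`: `(f_* F, a ↦ f_* [a]_F)`.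
[cite: Hazewinkel1978, §21.1 (21.1.4)] -/
def map {A' : Type w} [CommRing A'] [Algebra 𝒪 A'] (f : A →ₐ[𝒪] A') : FormalOModuleLaw 𝒪 A' where
  toFormalGroup := M.toFormalGroup.map f.toRingHom
  isComm := haveI := M.isComm; isComm_map M.toFormalGroup f.toRingHom
  act a := (M.act a).map f.toRingHom
  coeff_one_act a := by
    rw [FormalGroupHom.map_toPowerSeries, coeff_one_map, M.coeff_one_act]
    exact f.commutes a
  act_zero := by rw [FormalGroupHom.map_toPowerSeries, M.act_zero, map_zero]
  act_one := by rw [FormalGroupHom.map_toPowerSeries, M.act_one, PowerSeries.map_X]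
  act_add a b := by
    have hvec : (fun i => MvPowerSeries.map f.toRingHom ((![(M.act a).toPowerSeries, (M.act b).toPowerSeries] :
        Fin 2 → PowerSeries A) i)) = ![PowerSeries.map f.toRingHom (M.act a).toPowerSeries,
          PowerSeries.map f.toRingHom (M.act b).toPowerSeries] := by
      funext i; fin_cases i <;> rfl
    rw [FormalGroupHom.map_toPowerSeries, M.act_add]
    change MvPowerSeries.map f.toRingHom _ = _
    rw [MvPowerSeries.map_subst (hasSubst_pair (M.act a).hasSubst (M.act b).hasSubst), hvec]
    rfl
  act_mul a b := by
    rw [FormalGroupHom.map_toPowerSeries, M.act_mul]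
    change MvPowerSeries.map f.toRingHom _ = _
    rw [PowerSeries.map_subst (M.act b).hasSubst]
    rfl

/-- The underlying law of the base change is `f_* F`. [cite: Hazewinkel1978, §21.1 (21.1.4)] -/
@[simp] theorem map_toFormalGroup {A' : Type w} [CommRing A'] [Algebra 𝒪 A'] (f : A →ₐ[𝒪] A') :
    (M.map f).toFormalGroup = M.toFormalGroup.map f.toRingHom := rfl

/-- The action of the base change is `f_* [a]_F`. [cite: Hazewinkel1978, §21.1 (21.1.4)] -/
@[simp] theorem map_act {A' : Type w} [CommRing A'] [Algebra 𝒪 A'] (f : A →ₐ[𝒪] A') (a : 𝒪) :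
    (M.map f).act a = (M.act a).map f.toRingHom := rfl

end FormalOModuleLaw

/-! ## §3 The additive formal `𝒪`-module law -/

section Additive

variable (𝒪 : Type u) [CommRing 𝒪] (A : Type v) [CommRing A] [Algebra 𝒪 A]

/-- Scalar multiplication `T ↦ c·T` is an endomorphism of `𝔾̂ₐ`: `c(X + Y) = cX + cY`. [cite: Hazewinkel1978, §21.1 Ex. (21.1.2)] -/
def additiveEnd (c : A) : FormalGroupHom (FormalGroup.𝔾ₐ (R := A)) (FormalGroup.𝔾ₐ (R := A)) where
  toPowerSeries := c • PowerSeries.X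
  constantCoeff_eq_zero := by simp
  map_add := by
    have hF := hasSubst_formalGroup (FormalGroup.𝔾ₐ (R := A))
    have h0 : PowerSeries.HasSubst (MvPowerSeries.X 0 : MvPowerSeries (Fin 2) A) := PowerSeries.HasSubst.X 0
    have h1 : PowerSeries.HasSubst (MvPowerSeries.X 1 : MvPowerSeries (Fin 2) A) := PowerSeries.HasSubst.X 1
    have hc : HasSubst ![c • (MvPowerSeries.X 0 : MvPowerSeries (Fin 2) A), c • MvPowerSeries.X 1] :=
      MvPowerSeries.hasSubst_of_constantCoeff_zero fun s => by fin_cases s <;> simp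
    rw [PowerSeries.subst_smul hF, PowerSeries.subst_X hF, PowerSeries.subst_smul h0, PowerSeries.subst_X h0,
      PowerSeries.subst_smul h1, PowerSeries.subst_X h1, FormalGroup.𝔾ₐ_toPowerSeries,
      MvPowerSeries.subst_add hc, MvPowerSeries.subst_X hc, MvPowerSeries.subst_X hc]
    simp [smul_add]

/-- The series of `additiveEnd c` is `c·T`. [cite: Hazewinkel1978, §21.1 Ex. (21.1.2)] -/
@[simp] theorem additiveEnd_toPowerSeries (c : A) : (additiveEnd A c).toPowerSeries = c • PowerSeries.X := rfl

/-- The **additive formal `𝒪`-module law** `𝔾̂ₐ` over any `𝒪`-algebra `A`: `F = X + Y`, `[a](T) = a·T`.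
[cite: Hazewinkel1978, §21.1 Ex. (21.1.2)] -/
def FormalOModuleLaw.additive : FormalOModuleLaw 𝒪 A where
  toFormalGroup := FormalGroup.𝔾ₐ
  isComm := inferInstance
  act a := additiveEnd A (algebraMap 𝒪 A a)
  coeff_one_act a := by simp [Algebra.algebraMap_eq_smul_one]
  act_zero := by simp
  act_one := by simp
  act_add a b := by
    have hc : HasSubst ![algebraMap 𝒪 A a • (PowerSeries.X : PowerSeries A), algebraMap 𝒪 A b • PowerSeries.X] :=
      hasSubst_pair (PowerSeries.HasSubst.smul_X' _) (PowerSeries.HasSubst.smul_X' _)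
    rw [additiveEnd_toPowerSeries, additiveEnd_toPowerSeries, additiveEnd_toPowerSeries, FormalGroup.𝔾ₐ_toPowerSeries,
      MvPowerSeries.subst_add hc, MvPowerSeries.subst_X hc, MvPowerSeries.subst_X hc]
    simp [add_smul]
  act_mul a b := by
    have hb : PowerSeries.HasSubst (algebraMap 𝒪 A b • (PowerSeries.X : PowerSeries A)) :=
      PowerSeries.HasSubst.smul_X' _
    rw [additiveEnd_toPowerSeries, additiveEnd_toPowerSeries, additiveEnd_toPowerSeries, PowerSeries.subst_smul hb,
      PowerSeries.subst_X hb, map_mul, mul_smul]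

end Additive

/-! ## §4 Height -/

namespace FormalOModuleLaw

variable {𝒪 : Type u} [CommRing 𝒪] {A : Type v} [CommRing A] [Algebra 𝒪 A]

/-- **`𝒪`-height** of a formal `𝒪`-module law, as a `Prop`: `M` has height `h` with respect to the uniformiser `π` and
the residue cardinality `q` when `[π]_F(T) = u(T^{q^h})` for a series `u ∈ T·A⟦T⟧` whose linear coefficient is a unit
(so `[π]_F(T) = c·T^{q^h} + ` higher powers of `T^{q^h}`, `c ∈ Aˣ`).  Intended for `A` an algebra over the residue field
`𝒪∕π ≅ 𝔽_q`; no well-definedness in `h` is claimed here. [cite: Drinfeld1974, §1] [cite: HarrisTaylorAMS2001, §II.1 p. 59] -/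
def IsOfHeight (M : FormalOModuleLaw 𝒪 A) (π : 𝒪) (q h : ℕ) : Prop :=
  ∃ u : PowerSeries A, PowerSeries.constantCoeff u = 0 ∧ IsUnit (PowerSeries.coeff 1 u) ∧
    (M.act π).toPowerSeries = PowerSeries.subst ((PowerSeries.X : PowerSeries A) ^ (q ^ h)) u

/-- A law of height `h ≥ 1` (indeed any height with `q ^ h ≠ 1`) has `π = 0` in `A` on the tangent space:
`algebraMap 𝒪 A π = 0` unless `q ^ h = 1` — the linear coefficient of `u(T^{q^h})` vanishes for `q^h ≥ 2`.
[cite: HarrisTaylorAMS2001, §II.1 p. 59] -/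
theorem algebraMap_eq_zero_of_isOfHeight {M : FormalOModuleLaw 𝒪 A} {π : 𝒪} {q h : ℕ}
    (hM : M.IsOfHeight π q h) (hqh : 2 ≤ q ^ h) : algebraMap 𝒪 A π = 0 := by
  obtain ⟨u, -, -, hu⟩ := hM
  rw [← M.coeff_one_act π, hu, PowerSeries.coeff_subst_X_pow (by omega), if_neg (by rw [Nat.dvd_one]; omega)]

end FormalOModuleLaw

end Literature.RingTheory.FormalGroups
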